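import Literature.Probability.MarkovChains.BarkerAcceptance
import HarnessLib

/-!
# The two-coin Bernoulli factory for Barker's acceptance `c₁p₁/(c₁p₁ + c₂p₂)`, and why no coin
# algorithm realises the Metropolis ratio: `f(p) = 2p` is not simulable on `(0, ½)`

Topic `Probability/MarkovChains`; companion of `BarkerAcceptance.lean` (Barker's acceptance
`α_B = π(y)q(y,x)/(π(x)q(x,y) + π(y)q(y,x))`, its detailed balance, and Peskun's factor-two sandwich
`α_MH/2 ≤ α_B ≤ α_MH`).  This file types the reason Barker's rule matters for EXACT Monte Carlo with
intractable targets: when `π` (or a likelihood ratio) cannot be evaluated but EVENTS of probability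
proportional to it can be simulated — "coins" —, Barker's acceptance can be realised exactly by the
two-coin algorithm, whereas the Metropolis–Hastings acceptance `1 ∧ c p` cannot be realised by any
coin algorithm near the kink (Keane–O'Brien).  PUBLISHED RESULTS with our proofs; 0 named facts.

HONEST FRAMING: exact (Metropolis-corrected) sampling algorithms for lattice gauge theory; figures
of merit are autocorrelation/cost numbers at stated couplings and volumes; no continuum-physics claim.

## Sources (read on the materialised texts) and what is taken

* F. B. Gonçalves, K. Łatuszyński, G. O. Roberts, *Barker's algorithm for Bayesian inference with
  intractable likelihoods*, Braz. J. Probab. Stat. 31 (2017) 732–745 = arXiv:1709.07710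
  [GoncalvesLatuszynskiRoberts2017] (held text p0003–p0004): "This problem falls into the category of
  the classical … Bernoulli factory problem: given the probability `p` which we cannot evaluate but
  where events of this probability can be simulated, how can one simulate from an event of
  probability `f(p)`? … the function `f` takes the form … `f(p₃) = 1 ∧ c₃p₃` … it is known that in
  general there does not exist a solution when `f` takes [this] form"; **the 2-coin algorithm**
  "1. Sample `C₁ ∼ Ber(c₁/(c₁+c₂))`; 2. if `C₁ = 1`, sample `C₂ ∼ Ber(p₁)`; if `C₂ = 1`, output 1; if
  `C₂ = 0`, go back to 1; 3. if `C₁ = 0`, sample `C₂ ∼ Ber(p₂)`; if `C₂ = 1`, output 0; if `C₂ = 0`,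
  go back to 1" and "the above 2-coin algorithm outputs `1` with probability `c₁p₁/(c₁p₁+c₂p₂)` and
  `0` with probability `c₂p₂/(c₁p₁+c₂p₂)`. Furthermore, the number of loops needed until the algorithm
  stops is distributed as `Geom((c₁p₁+c₂p₂)/(c₁+c₂))` and hence the mean execution time is
  proportional to `(c₁+c₂)/(c₁p₁+c₂p₂)`."
* K. Łatuszyński, I. Kosmidis, O. Papaspiliopoulos, G. O. Roberts, *Simulating events of unknown
  probabilities via reverse time martingales*, Random Struct. Algorithms 38 (2011) 441–452 =
  arXiv:0907.4018 [LatuszynskiEtAl2011] (held text p0006): **Corollary 3.3** "An algorithm that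
  simulates `f(p) = 2p` for `p ∈ 𝒫 = (0, 1/2)` does not exist[s]", "a result originally established in
  [Keane–O'Brien] and also provided in [Nacu–Peres]", with proof by letting `p ↗ 1/2` against a
  lower bound of order `2^{−t₀}` on the probability of a fixed finite coin record.
* M. S. Keane, G. L. O'Brien, *A Bernoulli factory*, ACM TOMACS 4 (1994) 213–219 [KeaneOBrien1994]
  — the original necessary-and-sufficient conditions (cited through the two texts; not re-read).

## What is formalised

THE TWO-COIN ALGORITHM as its explicit round structure: with `a = c₁/(c₁+c₂)`, one round outputs
`1` with probability `a·p₁`, outputs `0` with probability `(1−a)·p₂`, and restarts with probability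
`ρ = 1 − a p₁ − (1−a)p₂`; the law of (number of restarts, output) is `n ↦ ρⁿ·a p₁`, `ρⁿ·(1−a)p₂`.
* `restartProb`, `restartProb_eq`, `restartProb_nonneg/_lt_one`;
* **`hasSum_twoCoin_one`** / **`hasSum_twoCoin_zero`** — `Σ_n ρⁿ a p₁ = c₁p₁/(c₁p₁+c₂p₂)`,
  `Σ_n ρⁿ (1−a) p₂ = c₂p₂/(c₁p₁+c₂p₂)` (the printed output law); **`twoCoin_terminates`** — the two
  add to `1` (almost-sure termination); **`hasSum_twoCoin_rounds`** — `Σ_n (n+1)ρⁿ(1−ρ) =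
  (c₁+c₂)/(c₁p₁+c₂p₂)` (mean number of loops of the `Geom((c₁p₁+c₂p₂)/(c₁+c₂))` law);
* **`twoCoin_eq_barkerRate`** — for any factorisation `c₁p₁ = π(y)T(y,x)`, `c₂p₂ = π(x)T(x,y)` the
  output-`1` probability IS Barker's acceptance of `BarkerAcceptance.lean`
  (`barkerRate T π x y = T x y · (that probability)`), so the chain driven by two-coin acceptances is
  `barkerKernel T π` — exact, reversible w.r.t. `π` (`barkerKernel_detailedBalance` there).
THE NO-GO in generating-function form: every coin protocol (adaptive, with auxiliary randomness,
almost surely finite) outputs `0` with probability `Σ_w c_w p^{#1(w)}(1−p)^{#0(w)}` summed over finite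
coin records `w`, with coefficients `c_w ≥ 0` (the conditional probability of stopping at `w` with
output `0`); `wordProb p w = p^{#1}(1−p)^{#0}`, `pow_length_le_wordProb`; non-vacuity on a genuine
protocol (private sanity lemmas `hasSum_twoHeads_one/_zero`: toss until a tail or two heads has laws
`p²`, `1 − p²` in this form);
* **`not_hasSum_one_sub_mul`** (`c > 1`) / **`not_hasSum_one_sub_two_mul`** (`c = 2`, the case of
  Corollary 3.3) — there are NO coefficients `a ≥ 0` with `Σ_w a_w·wordProb p w = 1 − c·p` for all
  `p ∈ (0, 1/c)`: hence no protocol outputs `1` with probability exactly `c·p = 1 ∧ c·p` on `(0, 1/c)`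
  (the analytic core of Keane–O'Brien's necessity: a record `w` charged at `p₀ = 1/(2c)` keeps
  probability `≥ a_w·min(p₀, 1 − 1/c)^{|w|}` as `p ↗ 1/c`, while `1 − c·p → 0`);
  `pow_min_length_le_wordProb` is the floor `P_p(w) ≥ min(p, 1−p)^{|w|}`;
* **`keaneOBrien_necessary`** — the "only if" half of Keane–O'Brien in the same form: if the
  output-`1`/`0` laws on `S ⊆ [0,1]` are `f`, `1 − f` with `f ≢ 0, 1`, then
  `min(f, 1 − f) ≥ min(p, 1 − p)ⁿ` on `S` for some `n` (`charged_le_of_hasSum`,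
  `exists_charged_of_hasSum_ne_zero`).

NOT formalised: the measure-theoretic definition of a sequential protocol and the (routine)
reduction of its output law to the series above; the continuity clause and the sufficiency direction
of Keane–O'Brien; Nacu–Peres fast simulation; the Portkey variants.

Context (cell pub-lqcd, HOME/R2-SCOPE.md §3, the admissible/inadmissible NOISY acceptance rules
N1–N4 / D2–D3 / D7: with only unbiased coin access to `e^{−ΔS}`-type ratios, an EXACT accept step
exists in Barker's form (two-coin) at Peskun's price ≤ 2 in the Dirichlet form, and does not exist in
Metropolis' form — the structural reason the exact noisy methods of the tree (Kennedy–Kuti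
`LinearAcceptance.lean`, `PseudoMarginal*.lean`) avoid a plug-in `min(1, r̂)`).
-/

noncomputable section

open Finset

namespace Literature.Probability.MarkovChains

namespace TwoCoin

/-! ### The two-coin algorithm: round structure and output law -/

/-- The restart probability of one round, `ρ = 1 − a p₁ − (1 − a) p₂` with `a = c₁/(c₁ + c₂)`.
[cite: GoncalvesLatuszynskiRoberts2017, §1 (the 2-coin algorithm, steps 1–3: "go back to 1")] -/
def restartProb (c₁ c₂ p₁ p₂ : ℝ) : ℝ := 1 - c₁ / (c₁ + c₂) * p₁ - c₂ / (c₁ + c₂) * p₂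

/-- `ρ = 1 − (c₁p₁ + c₂p₂)/(c₁ + c₂)`, i.e. a round stops with probability `(c₁p₁+c₂p₂)/(c₁+c₂)`
(the success parameter of the printed `Geom` law). [cite: GoncalvesLatuszynskiRoberts2017, §1
("distributed as `Geom((c₁p₁+c₂p₂)/(c₁+c₂))`")] -/
theorem restartProb_eq {c₁ c₂ : ℝ} (hc : c₁ + c₂ ≠ 0) (p₁ p₂ : ℝ) :
    restartProb c₁ c₂ p₁ p₂ = 1 - (c₁ * p₁ + c₂ * p₂) / (c₁ + c₂) := by
  unfold restartProb
  field_simp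
  ring

/-- `0 ≤ ρ` for coins `p₁, p₂ ≤ 1` and weights `c₁, c₂ ≥ 0`, `c₁ + c₂ > 0`.
[cite: GoncalvesLatuszynskiRoberts2017, §1 (2-coin algorithm)] -/
theorem restartProb_nonneg {c₁ c₂ p₁ p₂ : ℝ} (hc₁ : 0 ≤ c₁) (hc₂ : 0 ≤ c₂) (hc : 0 < c₁ + c₂)
    (hp₁ : p₁ ≤ 1) (hp₂ : p₂ ≤ 1) : 0 ≤ restartProb c₁ c₂ p₁ p₂ := by
  rw [restartProb_eq hc.ne', sub_nonneg, div_le_one hc]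
  nlinarith

/-- `ρ < 1` as soon as `c₁p₁ + c₂p₂ > 0` (some coin can fire).
[cite: GoncalvesLatuszynskiRoberts2017, §1 (2-coin algorithm)] -/
theorem restartProb_lt_one {c₁ c₂ p₁ p₂ : ℝ} (hc : 0 < c₁ + c₂) (hpos : 0 < c₁ * p₁ + c₂ * p₂) :
    restartProb c₁ c₂ p₁ p₂ < 1 := by
  rw [restartProb_eq hc.ne', sub_lt_self_iff]
  exact div_pos hpos hc

/-- **Output `1`**: the algorithm outputs `1` after exactly `n` restarts with probability `ρⁿ·a p₁`;
summing the geometric series, `P(output = 1) = c₁p₁/(c₁p₁ + c₂p₂)`.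
[cite: GoncalvesLatuszynskiRoberts2017, §1 ("outputs `1` with probability `c₁p₁/(c₁p₁+c₂p₂)`")] -/
theorem hasSum_twoCoin_one {c₁ c₂ p₁ p₂ : ℝ} (hc₁ : 0 ≤ c₁) (hc₂ : 0 ≤ c₂) (hc : 0 < c₁ + c₂)
    (hp₁ : p₁ ≤ 1) (hp₂ : p₂ ≤ 1) (hpos : 0 < c₁ * p₁ + c₂ * p₂) :
    HasSum (fun n : ℕ => restartProb c₁ c₂ p₁ p₂ ^ n * (c₁ / (c₁ + c₂) * p₁))
      (c₁ * p₁ / (c₁ * p₁ + c₂ * p₂)) := by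
  have hρ0 := restartProb_nonneg hc₁ hc₂ hc hp₁ hp₂
  have hρ1 := restartProb_lt_one hc hpos
  have h := (hasSum_geometric_of_lt_one hρ0 hρ1).mul_right (c₁ / (c₁ + c₂) * p₁)
  have hval : (1 - restartProb c₁ c₂ p₁ p₂)⁻¹ * (c₁ / (c₁ + c₂) * p₁) =
      c₁ * p₁ / (c₁ * p₁ + c₂ * p₂) := by
    rw [restartProb_eq hc.ne', sub_sub_cancel, inv_div]
    have hc' : c₁ + c₂ ≠ 0 := hc.ne'
    have hq : c₁ * p₁ + c₂ * p₂ ≠ 0 := hpos.ne'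
    field_simp
  rwa [hval] at h

/-- **Output `0`**: `P(output = 0) = Σ_n ρⁿ(1−a)p₂ = c₂p₂/(c₁p₁ + c₂p₂)`.
[cite: GoncalvesLatuszynskiRoberts2017, §1 ("and `0` with probability `c₂p₂/(c₁p₁+c₂p₂)`")] -/
theorem hasSum_twoCoin_zero {c₁ c₂ p₁ p₂ : ℝ} (hc₁ : 0 ≤ c₁) (hc₂ : 0 ≤ c₂) (hc : 0 < c₁ + c₂)
    (hp₁ : p₁ ≤ 1) (hp₂ : p₂ ≤ 1) (hpos : 0 < c₁ * p₁ + c₂ * p₂) :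
    HasSum (fun n : ℕ => restartProb c₁ c₂ p₁ p₂ ^ n * (c₂ / (c₁ + c₂) * p₂))
      (c₂ * p₂ / (c₁ * p₁ + c₂ * p₂)) := by
  have hρ0 := restartProb_nonneg hc₁ hc₂ hc hp₁ hp₂
  have hρ1 := restartProb_lt_one hc hpos
  have h := (hasSum_geometric_of_lt_one hρ0 hρ1).mul_right (c₂ / (c₁ + c₂) * p₂)
  have hval : (1 - restartProb c₁ c₂ p₁ p₂)⁻¹ * (c₂ / (c₁ + c₂) * p₂) =
      c₂ * p₂ / (c₁ * p₁ + c₂ * p₂) := by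
    rw [restartProb_eq hc.ne', sub_sub_cancel, inv_div]
    have hc' : c₁ + c₂ ≠ 0 := hc.ne'
    have hq : c₁ * p₁ + c₂ * p₂ ≠ 0 := hpos.ne'
    field_simp
  rwa [hval] at h

/-- **Almost-sure termination**: the output probabilities add up to `1`.
[cite: GoncalvesLatuszynskiRoberts2017, §1 ("the number of loops needed until the algorithm stops is
distributed as `Geom(…)`" — in particular finite almost surely)] -/
theorem twoCoin_terminates {c₁ c₂ p₁ p₂ : ℝ} (hpos : 0 < c₁ * p₁ + c₂ * p₂) :
    c₁ * p₁ / (c₁ * p₁ + c₂ * p₂) + c₂ * p₂ / (c₁ * p₁ + c₂ * p₂) = 1 := by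
  rw [← add_div, div_self hpos.ne']

/-- **Mean number of loops**: with stopping probability `s = 1 − ρ = (c₁p₁+c₂p₂)/(c₁+c₂)` per round,
`Σ_n (n+1)·ρⁿ·s = 1/s = (c₁+c₂)/(c₁p₁+c₂p₂)` — "the mean execution time is proportional to
`(c₁+c₂)/(c₁p₁+c₂p₂)`". [cite: GoncalvesLatuszynskiRoberts2017, §1 (Geom law and mean execution
time)] -/
theorem hasSum_twoCoin_rounds {c₁ c₂ p₁ p₂ : ℝ} (hc₁ : 0 ≤ c₁) (hc₂ : 0 ≤ c₂) (hc : 0 < c₁ + c₂)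
    (hp₁ : p₁ ≤ 1) (hp₂ : p₂ ≤ 1) (hpos : 0 < c₁ * p₁ + c₂ * p₂) :
    HasSum (fun n : ℕ => ((n : ℝ) + 1) * restartProb c₁ c₂ p₁ p₂ ^ n *
        (1 - restartProb c₁ c₂ p₁ p₂)) ((c₁ + c₂) / (c₁ * p₁ + c₂ * p₂)) := by
  set ρ := restartProb c₁ c₂ p₁ p₂ with hρ
  have hρ0 : 0 ≤ ρ := restartProb_nonneg hc₁ hc₂ hc hp₁ hp₂
  have hρ1 : ρ < 1 := restartProb_lt_one hc hpos
  -- `Σ (n+1) ρⁿ = Σ n ρⁿ + Σ ρⁿ = ρ/(1−ρ)² + 1/(1−ρ) = 1/(1−ρ)²`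
  have h1 : HasSum (fun n : ℕ => (n : ℝ) * ρ ^ n) (ρ / (1 - ρ) ^ 2) :=
    hasSum_coe_mul_geometric_of_norm_lt_one (by rwa [Real.norm_eq_abs, abs_of_nonneg hρ0])
  have h2 : HasSum (fun n : ℕ => ρ ^ n) (1 - ρ)⁻¹ := hasSum_geometric_of_lt_one hρ0 hρ1
  have h3 := (h1.add h2).mul_right (1 - ρ)
  have hne : 1 - ρ ≠ 0 := by linarith
  have hfun : (fun n : ℕ => ((n : ℝ) * ρ ^ n + ρ ^ n) * (1 - ρ)) =
      fun n : ℕ => ((n : ℝ) + 1) * ρ ^ n * (1 - ρ) := by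
    funext n; ring
  have h1ρ : 1 - ρ = (c₁ * p₁ + c₂ * p₂) / (c₁ + c₂) := by
    rw [hρ, restartProb_eq hc.ne']; ring
  have hval : (ρ / (1 - ρ) ^ 2 + (1 - ρ)⁻¹) * (1 - ρ) = (c₁ + c₂) / (c₁ * p₁ + c₂ * p₂) := by
    have : (ρ / (1 - ρ) ^ 2 + (1 - ρ)⁻¹) * (1 - ρ) = (1 - ρ)⁻¹ := by
      field_simp
      ring
    rw [this, h1ρ, inv_div]
  rwa [hfun, hval] at h3

/-- **The two-coin output probability IS Barker's acceptance.**  For a proposal `x → y` and ANY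
factorisation of the two Barker weights into a tractable constant times a coin probability,
`c₁p₁ = π(y)T(y,x)`, `c₂p₂ = π(x)T(x,y)` (GLR: "`α_B(θ, φ)`, which we write as `c₁p₁/(c₁p₁+c₂p₂)`"),
the output-`1` probability `c₁p₁/(c₁p₁+c₂p₂)` of `hasSum_twoCoin_one` is Barker's acceptance, and
`barkerRate T π x y = T(x,y)·P(output = 1)` — the off-diagonal entry of `barkerKernel T π`, which is
reversible with respect to `π` (`barkerKernel_detailedBalance`).
[cite: GoncalvesLatuszynskiRoberts2017, §1 ("the following 2-coin algorithm gives a simple way of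
simulating from an event of probability `α_B(θ, φ)`, which we write as `c₁p₁/(c₁p₁+c₂p₂)`")]
[cite: Peskun1973, §2.2 (Barker's choice `s_ij = 1`)] -/
theorem twoCoin_eq_barkerRate {X : Type*} (T : X → X → ℝ) (π : X → ℝ) (x y : X)
    {c₁ c₂ p₁ p₂ : ℝ} (h₁ : c₁ * p₁ = π y * T y x) (h₂ : c₂ * p₂ = π x * T x y) :
    T x y * (c₁ * p₁ / (c₁ * p₁ + c₂ * p₂)) = barkerRate T π x y := by
  unfold barkerRate
  rw [h₁, h₂, add_comm]

end TwoCoin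

/-! ### The no-go: `2p = 1 ∧ 2p` is not simulable on `(0, ½)` (Keane–O'Brien; LKPR Corollary 3.3) -/

namespace BernoulliFactory

/-- The probability that a `p`-coin produces the finite record `w` (`true` = heads):
`p^{#heads}(1 − p)^{#tails}`. [cite: LatuszynskiEtAl2011, §3 proof of Corollary 3.3 (the law
`ℙ_{p|t}` of the first `t` tosses)] -/
def wordProb (p : ℝ) : List Bool → ℝ
  | [] => 1
  | true :: w => p * wordProb p w
  | false :: w => (1 - p) * wordProb p w

/-- `wordProb p w ≥ 0` for `p ∈ [0, 1]`. [cite: LatuszynskiEtAl2011, §3 proof of Corollary 3.3] -/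
theorem wordProb_nonneg {p : ℝ} (hp0 : 0 ≤ p) (hp1 : p ≤ 1) : ∀ w, 0 ≤ wordProb p w
  | [] => zero_le_one
  | true :: w => mul_nonneg hp0 (wordProb_nonneg hp0 hp1 w)
  | false :: w => mul_nonneg (by linarith) (wordProb_nonneg hp0 hp1 w)

/-- **The change-of-measure floor**: for `0 ≤ p ≤ 1 − p` every record of length `t` has probability
`≥ p^t` (LKPR: "`inf_{p ∈ [1/4,1/2)} inf_A ℙ_{p|t₀}(A)/ℙ_{1/4|t₀}(A) ≥ 2^{−t₀}`" is the same floor in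
ratio form). [cite: LatuszynskiEtAl2011, §3 proof of Corollary 3.3] -/
theorem pow_length_le_wordProb {p : ℝ} (hp0 : 0 ≤ p) (hp : p ≤ 1 - p) :
    ∀ w : List Bool, p ^ w.length ≤ wordProb p w
  | [] => by simp [wordProb]
  | true :: w => by
      rw [List.length_cons, pow_succ', wordProb]
      exact mul_le_mul_of_nonneg_left (pow_length_le_wordProb hp0 hp w) hp0
  | false :: w => by
      rw [List.length_cons, pow_succ', wordProb]
      exact mul_le_mul (hp) (pow_length_le_wordProb hp0 hp w) (pow_nonneg hp0 _) (by linarith)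

/-- The two-sided floor: for `p ∈ [0, 1]` every record of length `t` has probability
`≥ (min p (1 − p))^t` — the quantity in Keane–O'Brien's criterion `min(f, 1 − f) ≥ min(p, 1 − p)ⁿ`.
[cite: LatuszynskiEtAl2011, §3 proof of Corollary 3.3] [cite: KeaneOBrien1994, (criterion, cited
through GoncalvesLatuszynskiRoberts2017 §1)] -/
theorem pow_min_length_le_wordProb {p : ℝ} (hp0 : 0 ≤ p) (hp1 : p ≤ 1) :
    ∀ w : List Bool, (min p (1 - p)) ^ w.length ≤ wordProb p w
  | [] => by simp [wordProb]
  | true :: w => by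
      rw [List.length_cons, pow_succ', wordProb]
      exact mul_le_mul (min_le_left _ _) (pow_min_length_le_wordProb hp0 hp1 w)
        (pow_nonneg (le_min hp0 (by linarith)) _) hp0
  | false :: w => by
      rw [List.length_cons, pow_succ', wordProb]
      exact mul_le_mul (min_le_right _ _) (pow_min_length_le_wordProb hp0 hp1 w)
        (pow_nonneg (le_min hp0 (by linarith)) _) (by linarith)

/-- Non-vacuity of the model on a genuine protocol — "toss until a tail or two heads; output `1` iff
two heads": its output-`1` law is carried by the single record `[H,H]`, `P_p([H,H]) = p²`. [folklore] -/
private theorem hasSum_twoHeads_one (p : ℝ) :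
    HasSum (fun w => (if w = [true, true] then (1 : ℝ) else 0) * wordProb p w) (p ^ 2) := by
  have hval : wordProb p [true, true] = p ^ 2 := by
    simp only [wordProb, mul_one]
    ring
  have h : HasSum (fun w => (if w = [true, true] then (1 : ℝ) else 0) * wordProb p w)
      ((if [true, true] = [true, true] then (1 : ℝ) else 0) * wordProb p [true, true]) :=
    hasSum_single [true, true] (fun w hw => by simp [hw])
  rwa [if_pos rfl, one_mul, hval] at h

/-- … and its output-`0` law is carried by the records `[T]`, `[H,T]`: `(1 − p) + p(1 − p) = 1 − p²`,
so the two laws are `f(p) = p²`, `1 − f(p)` as in `keaneOBrien_necessary` (with `n = 2` there).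
[folklore] -/
private theorem hasSum_twoHeads_zero (p : ℝ) :
    HasSum (fun w => (if w = [false] ∨ w = [true, false] then (1 : ℝ) else 0) * wordProb p w)
      (1 - p ^ 2) := by
  have h : HasSum (fun w => (if w = [false] ∨ w = [true, false] then (1 : ℝ) else 0) * wordProb p w)
      (∑ w ∈ ({[false], [true, false]} : Finset (List Bool)),
        (if w = [false] ∨ w = [true, false] then (1 : ℝ) else 0) * wordProb p w) :=
    hasSum_sum_of_ne_finset_zero (fun w hw => by
      have hw' : ¬ (w = [false] ∨ w = [true, false]) := by
        simpa [Finset.mem_insert, Finset.mem_singleton] using hw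
      simp [hw'])
  have hval : ∑ w ∈ ({[false], [true, false]} : Finset (List Bool)),
      (if w = [false] ∨ w = [true, false] then (1 : ℝ) else 0) * wordProb p w = 1 - p ^ 2 := by
    rw [Finset.sum_pair (by decide), if_pos (Or.inl rfl), if_pos (Or.inr rfl)]
    simp only [wordProb, one_mul, mul_one]
    ring
  rwa [hval] at h

/-- A charged record bounds the output probability from below on the whole parameter range:
`a_{w₀}·min(p, 1−p)^{|w₀|} ≤ a_{w₀}·P_p(w₀) ≤ Σ_w a_w P_p(w)`.
[cite: LatuszynskiEtAl2011, §3 proof of Corollary 3.3] [cite: KeaneOBrien1994, (necessity argument;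
cited through the two texts)] -/
theorem charged_le_of_hasSum {a : List Bool → ℝ} (ha0 : ∀ w, 0 ≤ a w) {p : ℝ} (hp0 : 0 ≤ p)
    (hp1 : p ≤ 1) {F : ℝ} (h : HasSum (fun w => a w * wordProb p w) F) (w₀ : List Bool) :
    a w₀ * (min p (1 - p)) ^ w₀.length ≤ F :=
  le_trans (mul_le_mul_of_nonneg_left (pow_min_length_le_wordProb hp0 hp1 w₀) (ha0 w₀))
    (le_hasSum h w₀ fun w _ => mul_nonneg (ha0 w) (wordProb_nonneg hp0 hp1 w))

/-- If the series `Σ_w a_w P_p(w)` has a nonzero value, some record is charged (`a_{w₀} ≠ 0`).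
[cite: LatuszynskiEtAl2011, §3 proof of Corollary 3.3 ("`δ := ℙ_{1/4}(S ≤ 1/2) > 0`")] -/
theorem exists_charged_of_hasSum_ne_zero {a : List Bool → ℝ} {p F : ℝ}
    (h : HasSum (fun w => a w * wordProb p w) F) (hF : F ≠ 0) : ∃ w₀, a w₀ ≠ 0 := by
  by_contra hnone
  have hzero : (fun w => a w * wordProb p w) = fun _ => 0 := by
    funext w
    have : a w = 0 := by
      by_contra h'; exact hnone ⟨w, h'⟩
    rw [this, zero_mul]
  rw [hzero] at h
  exact hF (h.unique hasSum_zero)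

/-- **Keane–O'Brien's necessary condition (generating-function form).**  Suppose that on a set of
coin biases `S ⊆ [0, 1]` a protocol outputs `1` with probability `f(p)` and `0` with probability
`1 − f(p)`, i.e. there are coefficients `a, b ≥ 0` on finite coin records with
`Σ_w a_w P_p(w) = f(p)` and `Σ_w b_w P_p(w) = 1 − f(p)` for `p ∈ S`, and that `f` is neither `≡ 0` nor
`≡ 1` on `S` (`f(p₀) > 0`, `f(p₁) < 1` for some `p₀, p₁ ∈ S`).  Then `f` is polynomially bounded away
from `0` and `1`: for some `n`, `min(f(p), 1 − f(p)) ≥ min(p, 1 − p)ⁿ` for all `p ∈ S` — the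
"only if" half of the Bernoulli-factory theorem (continuity aside).  In particular `f(p) = 1 ∧ c·p`
fails it on any `S` accumulating at `1/c` from below (`not_hasSum_one_sub_mul`).
[cite: KeaneOBrien1994, (the necessary-and-sufficient condition "`min(f, 1−f) ≥ min(p, 1−p)ⁿ`";
cited through GoncalvesLatuszynskiRoberts2017 §1 and LatuszynskiEtAl2011 §3, original not re-read)]
[cite: LatuszynskiEtAl2011, §3 Corollary 3.3 (proof pattern)] -/
theorem keaneOBrien_necessary {S : Set ℝ} (hS : S ⊆ Set.Icc 0 1) {f : ℝ → ℝ}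
    {a b : List Bool → ℝ} (ha0 : ∀ w, 0 ≤ a w) (hb0 : ∀ w, 0 ≤ b w)
    (ha : ∀ p ∈ S, HasSum (fun w => a w * wordProb p w) (f p))
    (hb : ∀ p ∈ S, HasSum (fun w => b w * wordProb p w) (1 - f p))
    {p₀ p₁ : ℝ} (hp₀ : p₀ ∈ S) (hf₀ : 0 < f p₀) (hp₁ : p₁ ∈ S) (hf₁ : f p₁ < 1) :
    ∃ n : ℕ, ∀ p ∈ S, (min p (1 - p)) ^ n ≤ min (f p) (1 - f p) := by
  obtain ⟨w₀, hw₀⟩ := exists_charged_of_hasSum_ne_zero (ha p₀ hp₀) hf₀.ne'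
  obtain ⟨w₁, hw₁⟩ := exists_charged_of_hasSum_ne_zero (hb p₁ hp₁) (by linarith : 1 - f p₁ ≠ 0)
  have haw : 0 < a w₀ := lt_of_le_of_ne (ha0 w₀) (Ne.symm hw₀)
  have hbw : 0 < b w₁ := lt_of_le_of_ne (hb0 w₁) (Ne.symm hw₁)
  -- absorb the constant `C = min(a_{w₀}, b_{w₁})` into `m` extra factors `min(p,1−p) ≤ ½`
  set C : ℝ := min (a w₀) (b w₁) with hC
  have hCpos : 0 < C := lt_min haw hbw
  obtain ⟨m, hm⟩ := exists_pow_lt_of_lt_one hCpos (by norm_num : (1 / 2 : ℝ) < 1)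
  refine ⟨max w₀.length w₁.length + m, fun p hp => ?_⟩
  have hp0 : 0 ≤ p := (hS hp).1
  have hp1 : p ≤ 1 := (hS hp).2
  have hq0 : 0 ≤ min p (1 - p) := le_min hp0 (by linarith)
  have hq1 : min p (1 - p) ≤ 1 := le_trans (min_le_left _ _) hp1
  have hqh : min p (1 - p) ≤ 1 / 2 := by
    rcases le_or_gt p (1 / 2) with h | h
    · exact le_trans (min_le_left _ _) h
    · exact le_trans (min_le_right _ _) (by linarith)
  have hqm : (min p (1 - p)) ^ m ≤ C :=
    le_trans (pow_le_pow_left₀ hq0 hqh m) hm.le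
  -- a generic step: `q^n ≤ q^{|w|}·q^m ≤ q^{|w|}·C ≤ coefficient·q^{|w|} ≤ value`
  have key : ∀ (w : List Bool) (coef F : ℝ), C ≤ coef → coef * (min p (1 - p)) ^ w.length ≤ F →
      w.length ≤ max w₀.length w₁.length →
      (min p (1 - p)) ^ (max w₀.length w₁.length + m) ≤ F := by
    intro w coef F hcoef hF hw
    calc (min p (1 - p)) ^ (max w₀.length w₁.length + m)
        ≤ (min p (1 - p)) ^ (w.length + m) :=
          pow_le_pow_of_le_one hq0 hq1 (by omega)
      _ = (min p (1 - p)) ^ w.length * (min p (1 - p)) ^ m := pow_add _ _ _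
      _ ≤ (min p (1 - p)) ^ w.length * coef :=
          mul_le_mul_of_nonneg_left (le_trans hqm hcoef) (pow_nonneg hq0 _)
      _ = coef * (min p (1 - p)) ^ w.length := mul_comm _ _
      _ ≤ F := hF
  exact le_min
    (key w₀ (a w₀) (f p) (min_le_left _ _) (charged_le_of_hasSum ha0 hp0 hp1 (ha p hp) w₀)
      (le_max_left _ _))
    (key w₁ (b w₁) (1 - f p) (min_le_right _ _) (charged_le_of_hasSum hb0 hp0 hp1 (hb p hp) w₁)
      (le_max_right _ _))

/-- **No coin protocol realises `f(p) = 1 ∧ c·p` on `(0, 1/c)` for any `c > 1`** (generating-function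
form): there are no coefficients `c_w ≥ 0` on finite coin records with
`Σ_w c_w · p^{#1(w)}(1−p)^{#0(w)} = 1 − c·p` for every `p ∈ (0, 1/c)` — as the output-`0` probability
of any almost surely finite protocol simulating `f(p) = c·p = 1 ∧ c·p` there would have to be.
Proof (the printed one, with `¼ ↦ 1/(2c)`): some record `w₀` is charged at `p₀ = 1/(2c)` (total
`½ > 0`); for `p ∈ [p₀, 1/c)` its term stays `≥ c_{w₀}·m^{|w₀|}`, `m = min(p₀, 1 − 1/c) > 0`, while
the total `1 − c·p ↘ 0` as `p ↗ 1/c`. [cite: GoncalvesLatuszynskiRoberts2017, §1 ("`f(p₃) =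
1 ∧ c₃p₃` … in general there does not exist a solution when `f` takes the form (3)")]
[cite: LatuszynskiEtAl2011, §3 Corollary 3.3 (the case `c = 2`) and its proof]
[cite: KeaneOBrien1994, (necessity half of the Bernoulli-factory theorem; cited through the two texts)] -/
theorem not_hasSum_one_sub_mul {c : ℝ} (hc : 1 < c) :
    ¬ ∃ a : List Bool → ℝ, (∀ w, 0 ≤ a w) ∧
      ∀ p ∈ Set.Ioo (0 : ℝ) (1 / c), HasSum (fun w => a w * wordProb p w) (1 - c * p) := by
  rintro ⟨a, ha0, hsum⟩
  have hc0 : 0 < c := by linarith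
  have hcinv : 0 < 1 / c := by positivity
  have hcinv1 : 1 / c < 1 := by rw [div_lt_one hc0]; exact hc
  -- at `p₀ = 1/(2c)` the total is `1/2 > 0`: some record `w₀` is charged
  set p₀ : ℝ := 1 / (2 * c) with hp₀
  have hp₀pos : 0 < p₀ := by positivity
  have hp₀c : c * p₀ = 1 / 2 := by rw [hp₀]; field_simp
  have hp₀I : p₀ ∈ Set.Ioo (0 : ℝ) (1 / c) := by
    refine ⟨hp₀pos, ?_⟩
    rw [hp₀]
    exact one_div_lt_one_div_of_lt hc0 (by linarith)
  obtain ⟨w₀, hw₀⟩ := exists_charged_of_hasSum_ne_zero (hsum p₀ hp₀I)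
    (by rw [hp₀c]; norm_num : 1 - c * p₀ ≠ 0)
  have haw : 0 < a w₀ := lt_of_le_of_ne (ha0 w₀) (Ne.symm hw₀)
  -- the floor `η = a_{w₀} m^{|w₀|} > 0`, `m = min(p₀, 1 − 1/c)`; take `p = 1/c − θ`
  set m : ℝ := min p₀ (1 - 1 / c) with hm
  have hmpos : 0 < m := lt_min hp₀pos (by linarith)
  set η : ℝ := a w₀ * m ^ w₀.length with hη
  have hηpos : 0 < η := mul_pos haw (pow_pos hmpos _)
  set θ : ℝ := min (p₀) (η / (2 * c)) with hθ
  have hθpos : 0 < θ := lt_min hp₀pos (by positivity)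
  have hθle : θ ≤ p₀ := min_le_left _ _
  have hθη : θ ≤ η / (2 * c) := min_le_right _ _
  have h2p₀ : p₀ + p₀ = 1 / c := by rw [hp₀]; field_simp; norm_num
  set p : ℝ := 1 / c - θ with hp
  have hpI : p ∈ Set.Ioo (0 : ℝ) (1 / c) := by
    constructor <;> [linarith; linarith]
  have hpp₀ : p₀ ≤ p := by linarith
  have hp0 : 0 ≤ p := by linarith
  have hp1 : p ≤ 1 := by linarith
  have hmin : m ≤ min p (1 - p) := le_min (le_trans (min_le_left _ _) hpp₀)
    (le_trans (min_le_right _ _) (by linarith))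
  -- one term is below the (nonnegative) sum `1 − c p = c θ`
  have hle : a w₀ * wordProb p w₀ ≤ 1 - c * p :=
    le_hasSum (hsum p hpI) w₀ fun w _ => mul_nonneg (ha0 w) (wordProb_nonneg hp0 hp1 w)
  -- but that term is at least `η`
  have hge : η ≤ a w₀ * wordProb p w₀ := by
    calc η = a w₀ * m ^ w₀.length := rfl
      _ ≤ a w₀ * (min p (1 - p)) ^ w₀.length :=
          mul_le_mul_of_nonneg_left (pow_le_pow_left₀ hmpos.le hmin _) haw.le
      _ ≤ a w₀ * wordProb p w₀ :=
          mul_le_mul_of_nonneg_left (pow_min_length_le_wordProb hp0 hp1 w₀) haw.le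
  -- `η ≤ 1 − c p = c θ ≤ η/2`: contradiction
  have hcp : 1 - c * p = c * θ := by
    rw [hp, mul_sub, mul_one_div_cancel hc0.ne']; ring
  have hcθ : c * θ ≤ η / 2 := by
    calc c * θ ≤ c * (η / (2 * c)) := mul_le_mul_of_nonneg_left hθη hc0.le
      _ = η / 2 := by field_simp
  linarith

/-- **No coin protocol outputs `1` with probability exactly `2p` on `(0, ½)`** (Keane–O'Brien;
Łatuszyński–Kosmidis–Papaspiliopoulos–Roberts Corollary 3.3), in generating-function form: there is
no family of coefficients `c_w ≥ 0` on finite coin records with `Σ_w c_w · p^{#1(w)}(1−p)^{#0(w)} =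
1 − 2p` for every `p ∈ (0, ½)` — as the output-`0` probability of any almost surely finite protocol
(adaptive stopping, auxiliary randomness) simulating `f(p) = 2p` would have to be: the case `c = 2`
of `not_hasSum_one_sub_mul` (whose proof is the printed one: charge a record `w₀` at `p = ¼`, where the
total is `½ > 0`; for `p ∈ [¼, ½)` its contribution stays `≥ c_{w₀}·4^{−|w₀|}` while `1 − 2p ↘ 0`).
[cite: LatuszynskiEtAl2011, §3 Corollary 3.3 and its proof] [cite: GoncalvesLatuszynskiRoberts2017,
§1 ("in general there does not exist a solution when `f` takes the form `1 ∧ c₃p₃`")]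
[cite: KeaneOBrien1994, (the necessity half of the Bernoulli-factory theorem — cited through the two
texts above; original not re-read here)] -/
theorem not_hasSum_one_sub_two_mul :
    ¬ ∃ c : List Bool → ℝ, (∀ w, 0 ≤ c w) ∧
      ∀ p ∈ Set.Ioo (0 : ℝ) (1 / 2), HasSum (fun w => c w * wordProb p w) (1 - 2 * p) :=
  not_hasSum_one_sub_mul one_lt_two

/-- The same statement read for the Metropolis function: `p ↦ 1 ∧ 2p` equals `2p` on `(0, ½)`, so no
coin protocol realises the Metropolis acceptance `1 ∧ (ratio)` from coins of the ratio on any set of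
ratios accumulating at the kink. [cite: GoncalvesLatuszynskiRoberts2017, §1 eq. `f(p₃) = 1 ∧ c₃p₃`
("in general there does not exist a solution")] -/
theorem min_one_two_mul_eq {p : ℝ} (hp : p ∈ Set.Ioo (0 : ℝ) (1 / 2)) : min 1 (2 * p) = 2 * p :=
  min_eq_right (by linarith [hp.2])

end BernoulliFactory

end Literature.Probability.MarkovChains
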